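import Literature.Analysis.FluidPDE.EyinkTransverseLimit
import Literature.Analysis.FluidPDE.DuchonRobertInviscidLimitProofs
import HarnessLib

/-!
# Eyink's local 4/5 law for `L³` weak Euler solutions: the accepted fact on tori of dimension `≤ 3`

Topic: Analysis/FluidPDE, proofs. Final assembly for the accepted named fact
`Torus.HasDuchonRobertDefect.hasFourFifthsLaw` (`DissipationAnomaly`; G. L. Eyink, Nonlinearity 16
(2003) 137–145, Thm. 1 / Cor. 1, made unconditional: every `L³` weak Euler solution with a
Duchon–Robert defect `D` satisfies the local 4/5 law with `D`). By `EyinkTransverseLimit`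
(`Torus.hasFourFifthsLaw_of_pressure_fact`) the fact follows, in every dimension, from the
Calderón–Zygmund pressure fact `Torus.exists_pressure_of_tendsto_L3`; the tree proves that fact from
the `L^p` Hessian bound on `T^d` (`Torus.exists_pressure_of_tendsto_L3_of`, `DuchonRobertPressure`),
hence unconditionally on every torus of dimension at most three
(`Torus.exists_pressure_of_tendsto_L3_of_card_le_three`, `DuchonRobertInviscidLimitProofs`, through
the Calderón–Zygmund theory of `Literature/Analysis/SingularIntegrals/` on `ℝ³` and descent along
coordinate embeddings), and from Stein's Prop. 3 on `ℝ^d` (`stein1970_hessian_Lp_bound`) in general —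
now itself proved in every dimension (`stein1970_hessian_Lp_bound_holds`,
`HessianLaplacianLpGeneralProofs`; torus form `FunctionSpaces.Torus.eLpNorm_hessian_le_laplacian_holds`,
pressure fact `Torus.exists_pressure_of_tendsto_L3_holds`, `DuchonRobertInviscidLimitProofs`), which
closes the accepted fact outright: `Torus.HasDuchonRobertDefect.hasFourFifthsLaw_holds`.

## Results (all proved)

* `Torus.hasFourFifthsLaw_of_CZ`: the fact from the torus Hessian bound
  `FunctionSpaces.Torus.eLpNorm_hessian_le_laplacian d` alone;
* `Torus.hasFourFifthsLaw_of_wholeSpace`: from `stein1970_hessian_Lp_bound (EuclideanSpace ℝ d)`;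
* `Torus.hasFourFifthsLaw_of_card_le_three`: **unconditionally for every finite index type of
  cardinality `≤ 3`**, in particular
* `Torus.HasDuchonRobertDefect.hasFourFifthsLaw_holds_fin3`: **the accepted fact on the physical
  torus `𝕋³`, proved** (Eyink's printed setting), and `…_holds_fin2`;
* `Torus.HasDuchonRobertDefect.hasFourFifthsLaw_holds`: **the discharge of the accepted fact over an
  arbitrary finite index type `d`** (every dimension), from the tree's discharge of the pressure fact
  `Torus.exists_pressure_of_tendsto_L3_holds`.

## References

* G. L. Eyink, *Local 4/5-law and energy dissipation anomaly in turbulence*, Nonlinearity 16 (2003)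
  137–145 = arXiv:nlin/0208004, Thm. 1, Cor. 1. [Eyink2003]
* J. Duchon, R. Robert, Nonlinearity 13 (2000) 249–255, Prop. 1–2. [DuchonRobert2000]
* E. M. Stein, *Singular integrals and differentiability properties of functions* (1970), Ch. III
  §1.3 Prop. 3. [Stein1971]
-/

noncomputable section

open MeasureTheory Set Filter

namespace Literature.Analysis.FluidPDE.Torus

variable {d : Type*} [Fintype d] {T : ℝ} {u : ℝ → UnitAddTorus d → EuclideanSpace ℝ d}

/-- **The local 4/5 law from the torus Calderón–Zygmund bound alone** (every other ingredient of
Eyink's proof is proved in the tree). [cite: Eyink2003, §2 Thm. 1 and Cor. 1] -/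
theorem hasFourFifthsLaw_of_CZ (hCZ : FunctionSpaces.Torus.eLpNorm_hessian_le_laplacian d) :
    HasDuchonRobertDefect.hasFourFifthsLaw (T := T) (u := u) := by
  classical
  exact hasFourFifthsLaw_of_pressure_fact (exists_pressure_of_tendsto_L3_of hCZ)

/-- **The local 4/5 law from Stein's whole-space Hessian bound in dimension `d`**
(`stein1970_hessian_Lp_bound (EuclideanSpace ℝ d)`, Stein 1970, III §1.3 Prop. 3). [cite: Eyink2003, §2 Thm. 1 and Cor. 1] -/
theorem hasFourFifthsLaw_of_wholeSpace (h : stein1970_hessian_Lp_bound (EuclideanSpace ℝ d)) :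
    HasDuchonRobertDefect.hasFourFifthsLaw (T := T) (u := u) := by
  classical
  exact hasFourFifthsLaw_of_pressure_fact (exists_pressure_of_tendsto_L3_of_wholeSpace h)

/-- **The local 4/5 law on tori of dimension at most three, unconditionally**: for every finite index
type `d` with `card d ≤ 3`, every `L³` weak Euler solution on `T^d × (0,T)` with a Duchon–Robert defect
satisfies `Torus.HasFourFifthsLaw` with that defect. [cite: Eyink2003, §2 Thm. 1 and Cor. 1] -/
theorem hasFourFifthsLaw_of_card_le_three (hcard : Fintype.card d ≤ 3) :
    HasDuchonRobertDefect.hasFourFifthsLaw (T := T) (u := u) := by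
  classical
  exact hasFourFifthsLaw_of_pressure_fact (exists_pressure_of_tendsto_L3_of_card_le_three hcard)

/-- **Eyink 2003, Thm. 1 / Cor. 1, unconditional, on the physical torus `𝕋³`**: the accepted fact
`HasDuchonRobertDefect.hasFourFifthsLaw` holds for `d = Fin 3`. [cite: Eyink2003, §2 Thm. 1 and Cor. 1] -/
theorem HasDuchonRobertDefect.hasFourFifthsLaw_holds_fin3 {T : ℝ}
    {u : ℝ → UnitAddTorus (Fin 3) → EuclideanSpace ℝ (Fin 3)} :
    HasDuchonRobertDefect.hasFourFifthsLaw (T := T) (u := u) :=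
  hasFourFifthsLaw_of_card_le_three (by simp)

/-- The accepted fact on the two-dimensional torus `𝕋²`, unconditionally. [cite: Eyink2003, §2 Thm. 1 and Cor. 1] -/
theorem HasDuchonRobertDefect.hasFourFifthsLaw_holds_fin2 {T : ℝ}
    {u : ℝ → UnitAddTorus (Fin 2) → EuclideanSpace ℝ (Fin 2)} :
    HasDuchonRobertDefect.hasFourFifthsLaw (T := T) (u := u) :=
  hasFourFifthsLaw_of_card_le_three (by simp)

/-- **Discharge of the named fact `Torus.HasDuchonRobertDefect.hasFourFifthsLaw`, in every
dimension** (Eyink 2003, Thm. 1, (1.7), made unconditional — the printed Cor. 1 assumes the shell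
limits exist; here their existence is part of the conclusion): for every finite index type `d`, every
`T` and every `L³` weak Euler solution `u` on `T^d × (0,T)` with a Duchon–Robert defect `D`, the
sphere-averaged third-order longitudinal structure function satisfies the local 4/5 law
`Torus.HasFourFifthsLaw T u D`. PROVED: `Torus.hasFourFifthsLaw_of_pressure_fact`
(`EyinkTransverseLimit`: Eyink's transverse balance `(uuT-eq)` for excised radial kernels from the
matrix-kernel identities, excision removed, uniform transverse defect, Cor. 1 on top of the 4/3 law;
`d = 0, 1` directly) fed with the tree's discharge of the Calderón–Zygmund pressure fact
`Torus.exists_pressure_of_tendsto_L3_holds` (`DuchonRobertInviscidLimitProofs`, from Stein 1970,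
III §1.3 Prop. 3 on `ℝ^d` in every dimension, `stein1970_hessian_Lp_bound_holds`). [cite: Eyink2003, §2 Thm. 1 (1.7) and Cor. 1] -/
theorem HasDuchonRobertDefect.hasFourFifthsLaw_holds :
    HasDuchonRobertDefect.hasFourFifthsLaw (T := T) (u := u) := by
  classical
  exact hasFourFifthsLaw_of_pressure_fact exists_pressure_of_tendsto_L3_holds

end Literature.Analysis.FluidPDE.Torus
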